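import Summits.CriticalPhenomena.PercolationContinuityZ3.Theorems.Transplant.PlanarCells2Defs
import HarnessLib

/-!
# Residue (C) of route D″ v2, PLANAR PART over the two-unit cells: record-agnostic containment facts for the corridor chain of the chosen probe
# `(v → x → x + du)` — the localisation rounds live in the cube box `Q_x`, the band run lives in `Q_x ∪ H_{x,du}`, and its last core enters the
# arrival box `M_{x+du} ∩ H_{x,du}` (the two-unit twin of `ChainPlanar.Sched.region_subset_Q_union_Hfull` / `core_last_subset`; companion of
# p2-g7's `KNCells2RootRunTwoUnit` for (R)); pure `Site 2` geometry over hp-8's `PCells2`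

builds on p205010 (kernel theorem, internal audit signed; external expert review pending) — nothing in this file uses p205010.
Lane `prim-bschramm`, seat `prim-bschramm-p5` (gen 6; (C) column of the D″ order of battle, DPRIME §5 / K.4; rulings R2/R3 05:09:29Z), helper file
(`--supports stmt-CriticalPhenomena-4575 --as helper`).  Record-agnostic: stated for signed boxes `sBox a σ (P.cen x) α β w`, so that both the
localisation schedule (`KNCells2ChainLocalise`: symmetric boxes, `σ = 1`, levels `[−α, α]`) and the band run (`KNCells2ChainBand(R)`: slabs along
`du`) plug in through their `region`/`core` descriptions, whatever the chain record.
* **`PCells2.sBox_symm_subset_Q`** — `{|level| ≤ α, |trans| ≤ w} ⊆ Q_x` for `α ≤ 5 r_a`, `w ≤ 5 r_{a⊥}` (the localisation region);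
* **`PCells2.sBox_subset_Q_union_Hfull`** — along `du`: `{−5r∥ ≤ level ≤ 22 r∥, |trans| ≤ 2 r⊥} ⊆ Q_x ∪ H_{x,du}` (the band-run regions);
* **`PCells2.sBox_subset_M_add_inter_Hfull`** — `{17 r∥ ≤ level ≤ 22 r∥, |trans| ≤ 2 r⊥} ⊆ M_{x+du} ∩ H_{x,du}` (the last core / arrival).
[cite: KozmaNitzan2024, §4 Lemma 12 (pp. 23–25), p. 26 (M_v, H_{v,x}), p. 31 (the corridor step)]
-/

noncomputable section

namespace Summit.CriticalPhenomena.PercolationContinuityZ3.Theorems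

namespace Transplant

namespace PCells2

open Literature.Probability.Percolation Literature.Probability.LatticeModels
open Literature.Probability.Percolation.KozmaNitzan
open Literature.Probability.Percolation.KozmaNitzan.Cells (oth oth_ne eq_oth_of_ne oth_oth sgOf sgOf_sign stepVec_apply_fst stepVec_apply_oth)

variable (P : PCells2)

/-- **The localisation region lies in the cube box**: a symmetric signed box about `cen x` of along-half-width `α ≤ 5 r_a` and transverse
half-width `w ≤ 5 r_{a⊥}` is inside `Q_x`. [cite: KozmaNitzan2024, §4 Lemma 12 (pp. 23–25)] -/
theorem sBox_symm_subset_Q (x : Site 2) (a : Fin 2) {α w : ℤ} (hα : α ≤ 5 * (P.r a : ℤ)) (hw : w ≤ 5 * (P.r (oth a) : ℤ)) :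
    sBox a 1 (P.cen x) (-α) α w ⊆ P.Q x := by
  intro y hy
  rw [mem_sBox_iff (Or.inl rfl)] at hy
  obtain ⟨⟨h1, h2⟩, hj⟩ := hy
  simp only [one_mul] at h1 h2
  rw [PCells2.Q, P.mem_abox_iff]
  intro i
  by_cases hi : i = a
  · subst hi
    push_cast
    exact ⟨by linarith, by linarith⟩
  · have hio := hj i hi
    have hri : P.r (oth a) = P.r i := by rw [← eq_oth_of_ne hi]
    rw [hri] at hw
    push_cast
    exact ⟨by linarith [hio.1], by linarith [hio.2]⟩

/-- **The band-run regions lie in the cube box or the corridor**: along `du`, a signed slab about `cen x` with levels in `[−5 r∥, 22 r∥]` and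
transverse half-width `ρ ≤ 2 r⊥` (`0 ≤ ρ`) is inside `Q_x ∪ H_{x,du}`. [cite: KozmaNitzan2024, §4 p. 26 (H_{v,x}), Lemma 11 (pp. 22–23)] -/
theorem sBox_subset_Q_union_Hfull (x : Site 2) (du : MDir) {α β ρ : ℤ} (hα : -(5 * (P.r du.1 : ℤ)) ≤ α) (hβ : β ≤ 22 * (P.r du.1 : ℤ))
    (hρ : ρ ≤ 2 * (P.r (oth du.1) : ℤ)) :
    sBox du.1 (sgOf du) (P.cen x) α β ρ ⊆ P.Q x ∪ P.Hfull x du := by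
  intro y hy
  rw [mem_sBox_iff (sgOf_sign du)] at hy
  obtain ⟨⟨h1, h2⟩, hj⟩ := hy
  have hr : (0 : ℤ) ≤ P.r (oth du.1) := by positivity
  by_cases hlev : sgOf du * (y du.1 - P.cen x du.1) ≤ 5 * (P.r du.1 : ℤ)
  · -- inside the cube box
    refine Finset.mem_union_left _ ?_
    rw [PCells2.Q, P.mem_abox_iff]
    intro i
    by_cases hi : i = du.1
    · subst hi
      push_cast
      rcases sgOf_sign du with hs | hs <;> rw [hs] at h1 h2 hlev <;> exact ⟨by linarith, by linarith⟩
    · have hio := hj i hi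
      have hri : P.r (oth du.1) = P.r i := by rw [← eq_oth_of_ne hi]
      rw [hri] at hρ hr
      push_cast
      exact ⟨by linarith [hio.1], by linarith [hio.2]⟩
  · -- inside the corridor
    push Not at hlev
    refine Finset.mem_union_right _ ?_
    rw [PCells2.Hfull, mem_sBox_iff (sgOf_sign du)]
    refine ⟨⟨by linarith, by linarith⟩, fun j hjj => ?_⟩
    have hio := hj j hjj
    exact ⟨by linarith [hio.1], by linarith [hio.2]⟩

/-- **The last core enters the arrival box**: along `du`, a signed slab about `cen x` with levels in `[17 r∥, 22 r∥]` and transverse half-width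
`ρ ≤ 2 r⊥` is inside `M_{x+du} ∩ H_{x,du}`. [cite: KozmaNitzan2024, §4 Lemma 12 (pp. 23–25: the run ends in the target box)] -/
theorem sBox_subset_M_add_inter_Hfull (x : Site 2) (du : MDir) {α β ρ : ℤ} (hα : 17 * (P.r du.1 : ℤ) ≤ α) (hβ : β ≤ 22 * (P.r du.1 : ℤ))
    (hρ : ρ ≤ 2 * (P.r (oth du.1) : ℤ)) :
    sBox du.1 (sgOf du) (P.cen x) α β ρ ⊆ P.M (x + stepVec du) ∩ P.Hfull x du := by
  intro y hy
  have hy' := hy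
  rw [mem_sBox_iff (sgOf_sign du)] at hy
  obtain ⟨⟨h1, h2⟩, hj⟩ := hy
  have hr : (0 : ℤ) ≤ P.r (oth du.1) := by positivity
  refine Finset.mem_inter.2 ⟨?_, ?_⟩
  · rw [PCells2.M, P.mem_abox_iff]
    intro i
    by_cases hi : i = du.1
    · subst hi
      rw [P.cen_add_stepVec_fst]
      push_cast
      rcases sgOf_sign du with hs | hs <;> rw [hs] at h1 h2 ⊢ <;> exact ⟨by linarith, by linarith⟩
    · have hio := hj i hi
      have hi' : i = oth du.1 := eq_oth_of_ne hi
      rw [hi', P.cen_add_stepVec_oth]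
      rw [hi'] at hio
      push_cast
      exact ⟨by linarith [hio.1], by linarith [hio.2]⟩
  · have h5 : -(5 * (P.r du.1 : ℤ)) ≤ α := by linarith [Int.natCast_nonneg (P.r du.1)]
    rcases Finset.mem_union.1 (P.sBox_subset_Q_union_Hfull x du h5 hβ hρ hy') with hQ | hH
    · -- a point of level `≥ 17 r∥` is not in the cube box
      exfalso
      rw [PCells2.Q, P.mem_abox_iff] at hQ
      have := hQ du.1
      push_cast at this
      have hr1 : (1 : ℤ) ≤ P.r du.1 := by exact_mod_cast P.one_le_r du.1
      rcases sgOf_sign du with hs | hs <;> rw [hs] at h1 <;> linarith [this.1, this.2]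
    · exact hH

end PCells2

end Transplant

end Summit.CriticalPhenomena.PercolationContinuityZ3.Theorems

end
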